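import Summits.AtomisticToContinuum.Crystallization.Theorems.FrustratedLawDichotomyStrainedPatchHomLeafTableTop
import Summits.AtomisticToContinuum.Crystallization.Theorems.FrustratedLawDichotomyStrainedPatchHomLeafTableCover

/-!
# v2 leaf checker — CERTIFICATION of the literal data (kernel `decide`): every table row passes `Row.ok tabE`; the label list is consistent, boxed,
# canonical, strictly key-sorted (hence label-nodup and `n`-sorted), and its class sums are `tabA0…tabA5`

decomp-a2c hand-1 g20.  `qTable_allOK` is ONE kernel evaluation over all 3713 rows (≈ 190 s farm kernel, measured); the list facts are cheap.  Together with
`leafCheck_sound_fcc` these make `leafCheck qTable nearLabels tabE tabA0 … tabA5 36 g sμ aμ = true` (one `decide` per leaf) a complete certificate of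
the (P4) fcc Gram-leaf floor, modulo the coverage fact `cover35` (stated here as a hypothesis-free theorem to be proved by enumeration; see NOTES).
`--supports stmt-AtomisticToContinuum-27623`.
-/

noncomputable section

namespace Summit.AtomisticToContinuum.Crystallization.Theorems.FrustratedLawDichotomyStrainedPatchHomLeafTableCheck

open scoped BigOperators RealInnerProductSpace
open Literature.Analysis.ValidatedNumerics.Numerics
open Summit.AtomisticToContinuum.Crystallization.Theorems.ChargedEnergyGapNegative (E3)
open Summit.AtomisticToContinuum.Crystallization.Theorems.FrustratedLawDichotomySchurCut (effPot w₄₅ ω₄)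
open Summit.AtomisticToContinuum.Crystallization.Theorems.FrustratedLawDichotomyStrainedPatchHomSplit (latPt)
open Literature.Barriers.AtomisticToContinuum.FlatleyTheil2015 (fccVec)
set_option maxHeartbeats 400000 in
/-- ★ Every row of the literal table passes its certification (generic or window mode). [kernel computation] -/
theorem qTable_allOK : QT.allOK tabE qTable = true := by decide +kernel

/-- The label records are consistent with their labels. [kernel computation] -/
theorem nearLabels_ok : allNLok nearLabels = true := by decide +kernel

/-- The labels lie in `[−7,7]³ ∖ 0`. [kernel computation] -/
theorem nearLabels_inBox : allInBox nearLabels = true := by decide +kernel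

/-- The labels are canonical (first non-zero coordinate positive). [kernel computation] -/
theorem nearLabels_canon : allCanon nearLabels = true := by decide +kernel

/-- The records are strictly increasing in `(n, b0, b1, b2)`. [kernel computation] -/
theorem nearLabels_chain : chainLt nearLabels = true := by decide +kernel

/-- The class sums. [kernel computation] -/
theorem nearLabels_sumM : sumM nearLabels = (tabA0, tabA1, tabA2, tabA3, tabA4, tabA5) := by decide +kernel

/-- ★ The list covers every box label of fcc norm `≤ 35` up to sign. [kernel computation] -/
theorem nearLabels_cover : coverCheck nearLabels = true := by decide +kernel

/-- ★★ **THE fcc GRAM-LEAF CERTIFICATE, assembled**: with the literal data certified above, a single kernel evaluation `leafCheck qTable nearLabels tabE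
tabA0 … tabA5 36 g sμ aμ = true` bounds the fcc box sum of every `G` with `‖G − 1‖ ≤ 1/4` whose frame Gram data lie in the box `g`. [folklore] -/
theorem boxSum_ge_of_leafCheck {g : GB} {sμ : Bool} {aμ : ℕ} (h : leafCheck qTable nearLabels tabE tabA0 tabA1 tabA2 tabA3 tabA4 tabA5 36 g sμ aμ = true)
    (G : E3 →L[ℝ]
      E3) (hG : ‖G - 1‖ ≤ 1 / 4)
    (hbox : ∀ i j : Fin 3, |⟪G (fccVec i), G (fccVec j)⟫ -
        ((g.cz i j : ℤ) : ℝ) / SC| ≤ ((g.wz i j : ℤ) : ℝ) / SC) :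
    ((sgnZ sμ aμ : ℤ) : ℝ) / SC ≤
      ∑ b ∈ (Fintype.piFinset fun _ : Fin 3 => Finset.Icc (-7 : ℤ) 7).filter (fun b => b ≠ 0),
        effPot w₄₅ ω₄ (3 / 400) ‖latPt G fccVec b‖ :=
  leafCheck_sound_fcc qTable_allOK (ok_of_allNLok nearLabels_ok) (box_of_allInBox nearLabels_inBox) (canon_hyp_of_allCanon nearLabels_canon)
    (nodup_sorted_of_chainLt nearLabels_ok nearLabels_chain).1 (classSums_of_sumM nearLabels_sumM) (cover_of_coverCheck nearLabels_cover)
    (nodup_sorted_of_chainLt nearLabels_ok nearLabels_chain).2 le_rfl h G hG hbox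

end Summit.AtomisticToContinuum.Crystallization.Theorems.FrustratedLawDichotomyStrainedPatchHomLeafTableCheck

end
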